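import Summits.BirchSwinnertonDyer.BirchSwinnertonDyer.Theorems.ResidualThetaTransportAtTwoThetaLayerLambdaCongruenceAtTwoStarKTwoOfFacts
import HarnessLib

/-!
# Crux `ThetaLayerLambdaCongruenceAtTwo` (stmt-BirchSwinnertonDyer-20688, route ResidualThetaTransportAtTwo), line
# `birth` v9, stub (C3k): ITEM B5 and (K2) AT THE CRUX'S OWN LEVEL — any `L` with `N·∏_{ℓ∈S} ℓ² ∣ L` and prime support
# `⊆ S` (the crux instantiates (C3k) at `N' = N_W · M · ∏_{v∈S₀} q_v²`, `M` the partner level, `…RescaledPlusLine` l.342)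
# (width seat bsd-wall-rtt-p3-w3 g3; `--supports stmt-BirchSwinnertonDyer-20688 --as helper`; closes nothing)

HONEST FRAMING. Flexible-level versions of `…StarDepletedForm` / `…StarAssemblyOfFacts` / `…StarKTwoOfFacts`. CONDITIONAL on
the named facts `eichlerShimura_depletedOptimalQuotient_periodLattice_of_dvd` (the flexible-level twin of p599108, landed
p602290), `isIsogenous_iff_frobeniusTrace_eq`,
`mazurKenku_exists_cyclic_isogeny`, `heckeSelfDual_torsionBy_J0`, and on ONE application input `hsub` (conclusion of
`buzzard2000_multiplicityOne_gamma0` at the explicit eigen-ideal). BSD is not proved by any of this.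

WHAT.
* `exists_depleted_eigenform_of_dvd` (§1): the `S`-depleted form of `f ∈ S₂(Γ₀(N))` at ANY level `L` with `N∏ℓ² ∣ L` and
  `primes(L) ⊆ primes(N) ∪ S` (push the level-`N∏ℓ²` form up by the tree's `toLevel0`; same `q`-expansion, same Hecke relations).
* `exists_periodFunctional_iotaConj_sub_notMem_of_dvd` (§2): ITEM B5 at level `L`.
* `kTwo_of_dvd` (§3): the lead's (K2) at level `L` from the facts and `hsub`, with `𝔪₀ ≠ ⊤`, `|𝕋/𝔪₀| = 2`, `𝔪₀` maximal proved.

References: Lines/birth-C3k-plan.md Addendum 2; [AgasheRibetStein2006] §2–3; [DarmonDiamondTaylor1995] §1.6, §4.5.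
-/

noncomputable section

-- justification: the `Summit.BirchSwinnertonDyer.BirchSwinnertonDyer.…` path repeats a component (route-file convention)
set_option linter.dupNamespace false

open scoped MatrixGroups ComplexConjugate ModularForm

open CongruenceSubgroup Complex WeierstrassCurve
open Literature.NumberTheory.EllipticCurves Literature.NumberTheory.EllipticCurves.ModularForms
open Literature.NumberTheory.EllipticCurves.Rank1Residual

namespace Summit.BirchSwinnertonDyer.BirchSwinnertonDyer.Theorems.ThetaLayerLambdaCongruenceAtTwo

/-! ## §1. The depleted eigenform at a flexible level -/

section Depleted

/-- Primes off `S` divide `L` iff they divide `N`, when `N ∣ L` and `primes(L) ⊆ primes(N) ∪ S`. [folklore] -/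
theorem dvd_iff_dvd_of_primeSupport {N L : ℕ} {S : Finset ℕ} (hNL : N ∣ L) (hLS : ∀ p : ℕ, p.Prime → p ∣ L → p ∣ N ∨ p ∈ S)
    {p : ℕ} (hp : p.Prime) (hpS : p ∉ S) : p ∣ L ↔ p ∣ N :=
  ⟨fun h ↦ (hLS p hp h).resolve_right hpS, fun h ↦ h.trans hNL⟩

/-- **The depleted eigenform at any admissible level.** For `f ∈ S₂(Γ₀(N))` with integer coefficients, `a₁ = 1`,
`T_p f = a_p(f) f` for all primes `p`, a finite set `S` of primes and a level `L` with `N·∏_{ℓ∈S} ℓ² ∣ L` and every prime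
factor of `L` dividing `N` or in `S`: there is `g ∈ S₂(Γ₀(L))` with `a_n(g) = 𝟙_{(n,S)=1} a_n(f)`, integer/real coefficients,
`a₁ = 1`, `T_p g = a_p(f) g` (`p ∉ S`), `U_ℓ g = 0` (`ℓ ∈ S`), `T_p g = a_p(g) g` for all `p`. [cite: AtkinLehner1970, §3] -/
theorem exists_depleted_eigenform_of_dvd {N : ℕ} [NeZero N] (f : CuspForm (Gamma0 N) 2)
    (hint : ∀ n : ℕ, ∃ z : ℤ, cuspCoeff f n = z) (h1 : cuspCoeff f 1 = 1)
    (hT : ∀ (p : ℕ) (hp : p.Prime), (haveI : NeZero p := ⟨hp.ne_zero⟩; heckeT (Gamma0 N) 2 p f) = cuspCoeff f p • f)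
    (S : Finset ℕ) (hS : ∀ ℓ ∈ S, ℓ.Prime) (L : ℕ) [NeZero L] (hNL : N * ∏ ℓ ∈ S, ℓ ^ 2 ∣ L)
    (hLS : ∀ p : ℕ, p.Prime → p ∣ L → p ∣ N ∨ p ∈ S) :
    ∃ g : CuspForm (Gamma0 L) 2,
      (∀ n : ℕ, cuspCoeff g n = if ∃ ℓ ∈ S, ℓ ∣ n then 0 else cuspCoeff f n) ∧
      (∀ n : ℕ, ∃ z : ℤ, cuspCoeff g n = z) ∧ (∀ n : ℕ, (cuspCoeff g n).im = 0) ∧ cuspCoeff g 1 = 1 ∧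
      (∀ (p : ℕ) (hp : p.Prime), p ∉ S → (haveI : NeZero p := ⟨hp.ne_zero⟩; heckeT (Gamma0 L) 2 p g) = cuspCoeff f p • g) ∧
      (∀ (ℓ : ℕ) (hℓ : ℓ.Prime), ℓ ∈ S → (haveI : NeZero ℓ := ⟨hℓ.ne_zero⟩; heckeT (Gamma0 L) 2 ℓ g) = 0) ∧
      (∀ (p : ℕ) (hp : p.Prime), (haveI : NeZero p := ⟨hp.ne_zero⟩; heckeT (Gamma0 L) 2 p g) = cuspCoeff g p • g) := by
  classical
  set L₀ : ℕ := N * ∏ ℓ ∈ S, ℓ ^ 2 with hL₀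
  haveI : NeZero L₀ := ⟨mul_ne_zero (NeZero.ne N) (prod_sq_ne_zero_of_prime S hS)⟩
  obtain ⟨g₀, hg₀⟩ := exists_cuspForm_coeff_eq_depleted f S hS L₀ rfl
  let g : CuspForm (Gamma0 L) 2 := toLevel0 hNL 2 g₀
  have hg : ∀ n : ℕ, cuspCoeff g n = if ∃ ℓ ∈ S, ℓ ∣ n then 0 else cuspCoeff f n := fun n ↦ by
    rw [← hg₀ n]; rfl
  have hreal : ∀ n : ℕ, (cuspCoeff f n).im = 0 := fun n ↦ by
    obtain ⟨z, hz⟩ := hint n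
    rw [hz, Complex.intCast_im]
  have hNL' : N ∣ L := (Dvd.intro _ rfl).trans hNL
  have hSL : ∀ ℓ ∈ S, ℓ ∣ L := fun ℓ hℓ ↦ (dvd_level_of_mem (M := N) (S := S) rfl hℓ).trans hNL
  refine ⟨g, hg, depleted_coeff_int hint hg, depleted_coeff_im hreal hg, (depleted_coeff_one hS hg).trans h1,
    fun p hp hpS ↦ depleted_heckeT_eq_smul hS hg hp hpS (dvd_iff_dvd_of_primeSupport hNL' hLS hp hpS) (hT p hp),
    fun ℓ hℓ hℓS ↦ depleted_heckeT_eq_zero hg hℓ hℓS (hSL ℓ hℓS),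
    depleted_heckeT_eq_coeff_smul hS hSL (fun p hp hpS ↦ dvd_iff_dvd_of_primeSupport hNL' hLS hp hpS) hg hT⟩

end Depleted

/-! ## §2. ITEM B5 and (K2) at a flexible level -/

section Flexible

/-- **ITEM B5 and (K2) at the crux's own level, from the facts.** `W/ℚ` globally minimal, good supersingular at `2`, `Δ_W < 0`;
newform `f` of level `N`; `S` a nonempty finite set of primes; a level `L` with `N·∏_{ℓ∈S} ℓ² ∣ L` and
`primes(L) ⊆ S` (so `S ⊇ primes(N)`); `𝔪₀ = span{2, T_q − a_q(W) (q ∤ L), T_ℓ (ℓ ∣ L)}`. Inputs: the flexible-level optimal-quotient fact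
`eichlerShimura_depletedOptimalQuotient_periodLattice_of_dvd`, Faltings, Mazur–Kenku, Hecke self-duality
of `J₀(L)[2]`, and `hsub` (conclusion of `buzzard2000_multiplicityOne_gamma0` at `𝔪₀`). Conclusions: (a) `𝔪₀ ≠ ⊤`, `|𝕋/𝔪₀| = 2`,
`𝔪₀` maximal; (b) (K2): every additive `K ⊇ 2Λ, (T_q^∨ − a_q(W))Λ, U_ℓ^∨Λ,` cusp-negation differences has
`x, y ∈ Λ ∖ K ⇒ x − y ∈ K`. [cite: DarmonDiamondTaylor1995, §1.6 Lemma 1.38 and §4.5 Thm. 4.26] -/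
theorem kTwo_of_dvd
    (hES : eichlerShimura_depletedOptimalQuotient_periodLattice_of_dvd)
    (hF : WeierstrassCurve.isIsogenous_iff_frobeniusTrace_eq) (hMK : mazurKenku_exists_cyclic_isogeny)
    (hSD : heckeSelfDual_torsionBy_J0)
    (W : WeierstrassCurve ℚ) [W.IsElliptic] [W.IsGloballyMinimal] (hss : GoodSS W 2) (hΔ : W.Δ < 0)
    {N : ℕ} [NeZero N] {f : CuspForm (Gamma0 N) 2} (hf : IsNewformOf W f)
    (S : Finset ℕ) (hS : ∀ ℓ ∈ S, ℓ.Prime) (hSne : S.Nonempty)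
    (L : ℕ) [NeZero L] (hNL : N * ∏ ℓ ∈ S, ℓ ^ 2 ∣ L) (hLS : ∀ p : ℕ, p.Prime → p ∣ L → p ∈ S)
    (hsub : Module.finrank (HeckeRing0 L 2 ⧸ Ideal.span ({t : HeckeRing0 L 2 | t = 2 ∨ (∃ (q : ℕ) (hq : q.Prime), ¬ q ∣ L ∧
          t = HeckeRing0.T L 2 q hq - (W.LFunction q : HeckeRing0 L 2)) ∨ (∃ (q : ℕ) (hq : q.Prime), q ∣ L ∧
          t = HeckeRing0.T L 2 q hq)}))
      (Submodule.torsionBySet (HeckeRing0 L 2) (J0 L) (Ideal.span ({t : HeckeRing0 L 2 | t = 2 ∨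
          (∃ (q : ℕ) (hq : q.Prime), ¬ q ∣ L ∧ t = HeckeRing0.T L 2 q hq - (W.LFunction q : HeckeRing0 L 2)) ∨
          (∃ (q : ℕ) (hq : q.Prime), q ∣ L ∧ t = HeckeRing0.T L 2 q hq)}))) = 2)
    (K : AddSubgroup (Module.Dual ℂ (CuspForm (Gamma0 L) 2)))
    (h2K : ∀ x ∈ periodHomology L, (2 : ℂ) • x ∈ K)
    (hTK : ∀ (q : ℕ) (hq : q.Prime), ¬ q ∣ L → ∀ x ∈ periodHomology L,
      (haveI : NeZero q := ⟨hq.ne_zero⟩; heckeT (Gamma0 L) 2 q).dualMap x - (W.LFunction q : ℂ) • x ∈ K)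
    (hUK : ∀ (q : ℕ) (hq : q.Prime), q ∣ L → ∀ x ∈ periodHomology L,
      (haveI : NeZero q := ⟨hq.ne_zero⟩; heckeT (Gamma0 L) 2 q).dualMap x ∈ K)
    (hcK : ∀ γ : Gamma0 L, periodFunctional L ⟨iotaConj (γ : SL(2, ℤ)), iotaConj_coe_mem_gamma0 γ⟩ - periodFunctional L γ ∈ K)
    {x y : Module.Dual ℂ (CuspForm (Gamma0 L) 2)} (hx : x ∈ periodHomology L) (hy : y ∈ periodHomology L)
    (hxK : x ∉ K) (hyK : y ∉ K) : x - y ∈ K := by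
  classical
  set G : Set (HeckeRing0 L 2) := {t : HeckeRing0 L 2 | t = 2 ∨ (∃ (q : ℕ) (hq : q.Prime), ¬ q ∣ L ∧
      t = HeckeRing0.T L 2 q hq - (W.LFunction q : HeckeRing0 L 2)) ∨ (∃ (q : ℕ) (hq : q.Prime), q ∣ L ∧
      t = HeckeRing0.T L 2 q hq)} with hGdef
  -- the depleted form at level `L`
  have hint : ∀ n : ℕ, ∃ z : ℤ, cuspCoeff f n = z := fun n ↦ ⟨W.LFunction n, hf.2 n⟩
  have hTf : ∀ (p : ℕ) (hp : p.Prime), (haveI : NeZero p := ⟨hp.ne_zero⟩; heckeT (Gamma0 N) 2 p f) = cuspCoeff f p • f :=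
    fun p hp ↦ by haveI : NeZero p := ⟨hp.ne_zero⟩; exact hf.1.heckeT_eq_coeff_smul hp
  have hLS' : ∀ p : ℕ, p.Prime → p ∣ L → p ∣ N ∨ p ∈ S := fun p hp h ↦ Or.inr (hLS p hp h)
  obtain ⟨g, hg', hgi, hgr, hg1, hgT, hgU, hgall⟩ := exists_depleted_eigenform_of_dvd f hint hf.1.2.2 hTf S hS L hNL hLS'
  have hg : ∀ n : ℕ, cuspCoeff g n = if ∃ ℓ ∈ S, ℓ ∣ n then 0 else (W.LFunction n : ℂ) := fun n ↦ by rw [hg' n, hf.2 n]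
  -- primes of `L` are exactly `S`
  have hSL : ∀ ℓ ∈ S, ℓ ∣ L := fun ℓ hℓ ↦ (dvd_level_of_mem (M := N) (S := S) rfl hℓ).trans hNL
  have hLiff : ∀ q : ℕ, q.Prime → (q ∣ L ↔ q ∈ S) := fun q hq ↦ ⟨hLS q hq, hSL q⟩
  -- the optimal quotient and `W ~ A`
  obtain ⟨A, hAell, hAmin, LA, c, hLA, hc, hlat, hfin⟩ := hES N f hf.1 hint S hS hSne L hNL hLS' g hg'
  have hiso : IsIsogenous W A := by
    refine (hF W A).mpr ?_
    set D : ℤ := W.minimalDiscriminantInt with hD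
    have hD0 : D ≠ 0 := W.minimalDiscriminantInt_ne_zero
    refine ((Set.finite_Iic D.natAbs).union ((S : Set ℕ).toFinite.union hfin)).subset ?_
    rintro p ⟨hp, hne⟩
    by_contra hmem
    simp only [Set.mem_union, Set.mem_Iic, Finset.mem_coe, Set.mem_setOf_eq, not_or] at hmem
    obtain ⟨hpD, hpS, hpA⟩ := hmem
    haveI : Fact p.Prime := ⟨hp⟩
    have hndvd : ¬ (p : ℤ) ∣ D := fun h ↦ hpD (Nat.le_of_dvd (Int.natAbs_pos.mpr hD0) (Int.ofNat_dvd_left.mp h))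
    have hgood : W.HasGoodReductionAtPrime p := hasGoodReductionAtPrime_of_not_dvd W p hndvd
    have h1 : (W.LFunction p : ℂ) = ((W.frobeniusTrace p : ℤ) : ℂ) := by
      rw [LFunction_apply_prime_eq_frobeniusTrace W p hgood]
    have h2' : cuspCoeff g p = (W.LFunction p : ℂ) := by
      rw [hg p, if_neg]
      rintro ⟨ℓ, hℓ, hd⟩
      exact hpS (((Nat.prime_dvd_prime_iff_eq (hS ℓ hℓ) hp).mp hd) ▸ hℓ)
    have h3 : ((A.frobeniusTrace p : ℤ) : ℂ) = cuspCoeff g p := by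
      by_contra h; exact hpA ⟨hp, h⟩
    apply hne
    have : ((W.frobeniusTrace p : ℤ) : ℂ) = ((A.frobeniusTrace p : ℤ) : ℂ) := by rw [← h1, ← h2', h3]
    exact_mod_cast this
  obtain ⟨ψ, hcyc, -⟩ := hMK W A hiso
  -- the eigen-ideal acts on `g` by even integers and contains `2`
  have h2 : (2 : HeckeRing0 L 2) ∈ Ideal.span G := Ideal.subset_span (Or.inl rfl)
  have hb : ∀ (q : ℕ) (hq : q.Prime), (haveI : NeZero q := ⟨hq.ne_zero⟩; heckeT (Gamma0 L) 2 q g) =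
      (((if q ∈ S then 0 else W.LFunction q : ℤ)) : ℂ) • g := fun q hq ↦ by
    rw [hgall q hq, hg q]
    by_cases hqS : q ∈ S
    · rw [if_pos ⟨q, hqS, dvd_rfl⟩, if_pos hqS, Int.cast_zero]
    · rw [if_neg, if_neg hqS]
      rintro ⟨ℓ, hℓ, hd⟩
      exact hqS (((Nat.prime_dvd_prime_iff_eq (hS ℓ hℓ) hq).mp hd) ▸ hℓ)
  have h𝔪 : ∀ t ∈ Ideal.span G, ∃ e : ℤ, HeckeRing0.toEnd L 2 t g = ((2 * e : ℤ) : ℂ) • g := by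
    refine ideal_span_acts_even g (fun q ↦ if q ∈ S then 0 else W.LFunction q) hb G fun t ht ↦ ?_
    rcases ht with rfl | ⟨q, hq, hqL, rfl⟩ | ⟨q, hq, hqL, rfl⟩
    · exact Or.inl rfl
    · refine Or.inr ⟨q, hq, ?_⟩
      rw [if_neg (fun h ↦ hqL ((hLiff q hq).mpr h))]
    · refine Or.inr ⟨q, hq, ?_⟩
      rw [if_pos ((hLiff q hq).mp hqL), Int.cast_zero, sub_zero]
  -- B5 at level `L`: a witness outside `𝔪₀Λ`, hence `𝔪₀ ≠ ⊤`, `|𝕋/𝔪₀| = 2`, maximal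
  obtain ⟨γ₀, hγ₀⟩ := exists_periodFunctional_iotaConj_add_notMem_of_optimalQuotient W hss hΔ g hgr A hLA hc hlat ψ hcyc
    (Ideal.span G) h𝔪
  have hne : Ideal.span G ≠ ⊤ := by
    intro htop
    apply hγ₀
    rw [htop, Submodule.top_smul]
    exact (mem_periodHomologyHecke L).mpr
      (add_mem (periodFunctional_mem_periodHomology L _) (periodFunctional_mem_periodHomology L γ₀))
  have hq := natCard_quotient_eq_two_of_ne_top (Ideal.span G) h2 (eigenIdeal_T_sub_int_mem W) hne
  haveI : (Ideal.span G).IsMaximal := isMaximal_of_natCard_quotient_eq_two _ hq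
  -- B4 quotient form from `hsub` and the self-duality pairing, then the (K2) glue
  obtain ⟨B, hbal, hleft, -⟩ := hSD L 2
  obtain ⟨v₁, -, v₂, hv₂, hcos⟩ := exists_fourCosets_periodHomology_of_multiplicityOne _ h2 hq hsub B hbal hleft
  have hK𝔪 : ∀ z ∈ Ideal.span G • periodHomologyHecke L, z ∈ K := by
    refine mem_of_mem_ideal_span_smul G K fun s hs z hz ↦ ?_
    rcases hs with rfl | ⟨q, hq', hqL, rfl⟩ | ⟨q, hq', hqL, rfl⟩
    · have : (2 : HeckeRing0 L 2) • z = (2 : ℂ) • z := by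
        rw [show (2 : HeckeRing0 L 2) = ((2 : ℤ) : HeckeRing0 L 2) by norm_num, heckeRing0_intCast_smul, Int.cast_ofNat]
      rw [this]
      exact h2K z hz
    · rw [sub_smul, heckeRing0_T_smul, heckeRing0_intCast_smul]
      exact hTK q hq' hqL z hz
    · rw [heckeRing0_T_smul]
      exact hUK q hq' hqL z hz
  exact indexTwo_of_fourCosets_of_optimalQuotient W hss hΔ g hgr A hLA hc hlat ψ hcyc (Ideal.span G) h2 h𝔪 K hK𝔪 hcK hv₂
    hcos hx hy hxK hyK

end Flexible

end Summit.BirchSwinnertonDyer.BirchSwinnertonDyer.Theorems.ThetaLayerLambdaCongruenceAtTwo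

end
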